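import Mathlib
import Summits.Ventures.PercRepro.TriangleCapFourArith
import Summits.Ventures.PercRepro.TriangleCapRowTPieces

/-!
# PercRepro — THE ROW `a = 4` AT `r = 4 + j`: the pieces — the window, the all-off read and the sides at `a = 4`
(p3, gen 49; part 205d)

The pieces of part 203d at `a = 4` (`k ≥ 12 + j`); the mixed core `mixed_vertex_core_T` and the mixed-read arithmetic
of part 203c carry no bound on `a` and are used as they are. Axioms: standard.
-/

namespace PercRepro

namespace TriangleCap

namespace C047

open Finset

variable {V : Type*} [Fintype V] [DecidableEq V]

omit [DecidableEq V] in
/-- **THE WINDOW `[4, k − 4 − 1]` ON `(k, 4, 4 + j)`:** every degree in `[4, k − 4 − 1]` gives the one-triangle target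
(`k ≥ 12 + j`). -/
theorem rowFour_window (D : SimpleGraph V) [DecidableRel D.Adj] (j : ℕ)
    (hk : 12 + j ≤ Fintype.card V) (hm : D.edgeFinset.card + (4 + j) = 4 * (Fintype.card V - 4))
    (hcap : ∀ v, deg D v + 4 + 1 ≤ Fintype.card V) (hdeg : ∀ v, 4 ≤ deg D v) :
    ∑ v, deg D v * deg D v + (4 + j) * (Fintype.card V - 1 - (4 + j)) +
        (2 * Fintype.card V - 14 + 2 * j * (4 - 3)) ≤
      D.edgeFinset.card * Fintype.card V := by
  have hsum : ∑ v, (deg D v * deg D v + 4 * (Fintype.card V - 4 - 1)) ≤ ∑ v, (Fintype.card V - 1) * deg D v :=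
    sum_le_sum (fun v _ => convex_vertex_window (deg D v) (Fintype.card V) 4 (hdeg v) (hcap v))
  rw [sum_add_distrib, sum_const, card_univ, smul_eq_mul, ← mul_sum, sum_deg_eq] at hsum
  obtain ⟨k, hk'⟩ : ∃ k, Fintype.card V = k := ⟨_, rfl⟩
  obtain ⟨S, hS⟩ : ∃ S, ∑ v, deg D v * deg D v = S := ⟨_, rfl⟩
  obtain ⟨m, hmdef⟩ : ∃ m, D.edgeFinset.card = m := ⟨_, rfl⟩
  rw [hk'] at hsum hm hk
  rw [hS, hmdef] at hsum
  rw [hmdef] at hm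
  rw [hS, hk', hmdef]
  have h1 : 4 ≤ k := by omega
  have h2 : 1 ≤ k - 4 := by omega
  have h3 : 1 ≤ k := by omega
  have h4 : 4 + j ≤ k - 1 := by omega
  have h5 : 14 ≤ 2 * k := by omega
  zify [h1, h2, h3, h4, h5] at hsum hm ⊢
  nlinarith [hsum, hm, Nat.zero_le (j * j)]

/-- **THE ALL-OFF READ ON `(k, 4, 4 + j)`:** `D − z ⊆ K(A′, A′ᶜ)`, every neighbour of `z` off `A′`, some
neighbour `w₀` ⇒ the one-triangle target (the plain star bound of `D − z`, the off-side neighbours at `≤ 4`). -/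
theorem rowFour_alloff (D : SimpleGraph V) [DecidableRel D.Adj] (j : ℕ)
    (hk : 12 + j ≤ Fintype.card V) (hm : D.edgeFinset.card + (4 + j) = 4 * (Fintype.card V - 4)) (z : V)
    (hz : deg D z + 1 ≤ 4) (A' : Finset {v : V // v ≠ z}) (hA'card : A'.card = 4) (hB : BipSub (del D z) A')
    (hm' : (del D z).edgeFinset.card + (deg D z + j) = 4 * (Fintype.card {v : V // v ≠ z} - 4))
    (hnone : ∀ w : {v : V // v ≠ z}, D.Adj w.1 z → w ∉ A') (w₀ : {v : V // v ≠ z}) (hw₀z : D.Adj w₀.1 z) :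
    ∑ v, deg D v * deg D v + (4 + j) * (Fintype.card V - 1 - (4 + j)) +
        (2 * Fintype.card V - 14 + 2 * j * (4 - 3)) ≤
      D.edgeFinset.card * Fintype.card V := by
  have hcard' := card_del z
  have hedges' := card_edges_del D z
  have hsq := sum_deg_sq_del D z
  obtain ⟨Nz, hNzdef⟩ : ∃ Nz : Finset {v : V // v ≠ z},
      Nz = univ.filter (fun w : {v : V // v ≠ z} => D.Adj w.1 z) := ⟨_, rfl⟩
  have hmemNz : ∀ w : {v : V // v ≠ z}, w ∈ Nz ↔ D.Adj w.1 z := fun w => by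
    rw [hNzdef, mem_filter]
    simp only [mem_univ, true_and]
  have hNz : Nz.card = deg D z := by rw [hNzdef]; exact card_nbhd_del D z
  have hz1 : 1 ≤ deg D z := by
    rw [← hNz]
    exact card_pos.mpr ⟨w₀, (hmemNz w₀).mpr hw₀z⟩
  have hTfilt : ∑ w : {v : V // v ≠ z}, (if D.Adj w.1 z then deg (del D z) w else 0) =
      ∑ w ∈ Nz, deg (del D z) w := by
    rw [hNzdef, sum_filter]
  have hT : ∑ w ∈ Nz, deg (del D z) w ≤ deg D z * 4 := by
    rw [← hNz, ← smul_eq_mul, ← sum_const]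
    apply sum_le_sum
    intro w hw
    have := deg_le_card_of_bipSub (del D z) A' hB w (hnone w ((hmemNz w).mp hw))
    rw [hA'card] at this
    exact this
  have hS' := sum_deg_sq_le_of_bipSub (del D z) A' hB 4 (deg D z + j) hA'card hm' (by omega)
  rw [hsq, hTfilt, ← hedges']
  obtain ⟨T, hTdef⟩ : ∃ T, ∑ w ∈ Nz, deg (del D z) w = T := ⟨_, rfl⟩
  obtain ⟨S', hS'def⟩ : ∃ S', ∑ w : {v : V // v ≠ z}, deg (del D z) w * deg (del D z) w = S' := ⟨_, rfl⟩
  obtain ⟨m', hm'def⟩ : ∃ m', (del D z).edgeFinset.card = m' := ⟨_, rfl⟩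
  rw [hTdef, hS'def, hm'def]
  rw [hTdef] at hT
  rw [hS'def, hm'def] at hS'
  rw [hm'def] at hm' hedges'
  have hcardV' : Fintype.card {v : V // v ≠ z} = Fintype.card V - 1 := by omega
  rw [hcardV'] at hS' hm'
  have hmd : m' + deg D z + (4 + j) = 4 * (Fintype.card V - 4) := by
    have := below_cell_edges 4 (4 + j) (deg D z + j) (deg D z) (Fintype.card V) D.edgeFinset.card m' (by omega)
      (by omega) hedges' hm
    omega
  exact rowT_alloff_arith_four j (deg D z) (Fintype.card V) m' S' T hz1 hz hk hmd hS' hT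

/-- **THE SIDES OF AN `4`-BIPARTITE `D − z` ON `(k, 4, 4 + j)`:** `D` is `4`-bipartite, or at the
one-triangle target, or `z` has a neighbour `w₀` off the side and `w₁` on it, `2 ≤ d(z)`, `T + (k − 4 − 2) ≤ d(z)(k − 4 − 2) + 4`. -/
theorem sides_four_gen (D : SimpleGraph V) [DecidableRel D.Adj] (j : ℕ)
    (hk : 12 + j ≤ Fintype.card V) (hm : D.edgeFinset.card + (4 + j) = 4 * (Fintype.card V - 4)) (z : V)
    (hz : deg D z + 1 ≤ 4) (A' : Finset {v : V // v ≠ z}) (hA'card : A'.card = 4) (hB : BipSub (del D z) A')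
    (hm' : (del D z).edgeFinset.card + (deg D z + j) = 4 * (Fintype.card {v : V // v ≠ z} - 4))
    (hcap : ∀ v, deg D v ≤ (Fintype.card V - 4 - 2) + 1) :
    (∃ A : Finset V, A.card = 4 ∧ BipSub D A) ∨
      (∑ v, deg D v * deg D v + (4 + j) * (Fintype.card V - 1 - (4 + j)) +
          (2 * Fintype.card V - 14 + 2 * j * (4 - 3)) ≤ D.edgeFinset.card * Fintype.card V) ∨
      (2 ≤ deg D z ∧ (∃ w₀ : {v : V // v ≠ z}, w₀ ∉ A' ∧ D.Adj w₀.1 z) ∧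
        (∃ w₁ : {v : V // v ≠ z}, w₁ ∈ A' ∧ D.Adj w₁.1 z) ∧
        ∑ w : {v : V // v ≠ z}, (if D.Adj w.1 z then deg (del D z) w else 0) + (Fintype.card V - 4 - 2) ≤
          deg D z * (Fintype.card V - 4 - 2) + 4) := by
  by_cases hall : ∀ w : {v : V // v ≠ z}, D.Adj w.1 z → w ∈ A'
  · obtain ⟨B, hBcard, hBsub⟩ := bipSub_lift D z A' hB hall
    exact Or.inl ⟨B, by rw [hBcard, hA'card], hBsub⟩
  by_cases hnone : ∀ w : {v : V // v ≠ z}, D.Adj w.1 z → w ∉ A'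
  · right; left
    push Not at hall
    obtain ⟨w₀, hw₀z, _⟩ := hall
    exact rowFour_alloff D j hk hm z hz A' hA'card hB hm' hnone w₀ hw₀z
  · right; right
    push Not at hall hnone
    obtain ⟨w₀, hw₀z, hw₀A⟩ := hall
    obtain ⟨w₁, hw₁z, hw₁A⟩ := hnone
    have hne : w₀ ≠ w₁ := fun h => hw₀A (h ▸ hw₁A)
    obtain ⟨Nz, hNzdef⟩ : ∃ Nz : Finset {v : V // v ≠ z},
        Nz = univ.filter (fun w : {v : V // v ≠ z} => D.Adj w.1 z) := ⟨_, rfl⟩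
    have hmemNz : ∀ w : {v : V // v ≠ z}, w ∈ Nz ↔ D.Adj w.1 z := fun w => by
      rw [hNzdef, mem_filter]
      simp only [mem_univ, true_and]
    have hNz : Nz.card = deg D z := by rw [hNzdef]; exact card_nbhd_del D z
    refine ⟨?_, ⟨w₀, hw₀A, hw₀z⟩, ⟨w₁, hw₁A, hw₁z⟩, ?_⟩
    · have hsub : ({w₀, w₁} : Finset {v : V // v ≠ z}) ⊆ Nz := by
        intro w hw
        rw [mem_insert, mem_singleton] at hw
        rcases hw with rfl | rfl
        · exact (hmemNz _).mpr hw₀z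
        · exact (hmemNz _).mpr hw₁z
      have := card_le_card hsub
      rw [card_pair hne] at this
      omega
    · have hTfilt : ∑ w : {v : V // v ≠ z}, (if D.Adj w.1 z then deg (del D z) w else 0) =
          ∑ w ∈ Nz, deg (del D z) w := by
        rw [hNzdef, sum_filter]
      rw [hTfilt, ← hNz]
      have hdw₀ : deg (del D z) w₀ ≤ 4 := by
        have := deg_le_card_of_bipSub (del D z) A' hB w₀ hw₀A
        rw [hA'card] at this
        exact this
      exact sum_le_of_mem_le_gen Nz (fun w => deg (del D z) w) (Fintype.card V - 4 - 2) 4 ((hmemNz w₀).mpr hw₀z)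
        (fun w hw => by
          have h := deg_del D z w
          rw [if_pos ((hmemNz w).mp hw)] at h
          have := hcap w.1
          omega) hdw₀

end C047

end TriangleCap

end PercRepro
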